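import Mathlib

/-!
# Crux `ClassTransfer` (stmt-ValiantsHypothesis-7287), negative side — flattening tools:
# `dim R ≥ rank` of any flattening, and the coincidence kernel `4^{#{i : α i = γ i}}` on `S_m`

Lead prover of line `registered` (= `Cruxes/ClassTransfer/Lines/birth.lean`).  The crux
`…Theses.FermionizationDimension.ClassTransfer` is about COMMUTATIVE TWISTING REALISATIONS
`ℓ(∏_i u_{σ(i),i}) = f(σ)` of a function `f` on `S_n` by a commutative `ℂ`-algebra `R`, a
matrix `u ∈ R^{n×n}` and a functional `ℓ`.  Two pure-Mathlib tools for LOWER bounds on `dim R`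
(the route header records that nothing beyond `s ≥ 2` was in tree):

* `card_le_finrank_of_flattening` — the FLATTENING BOUND: if `ℓ(P α · Q β) = M α β` for families
  `P, Q : ι → R` and `M` is nonsingular then `dim R ≥ #ι` (the `Q β` are linearly independent:
  a relation `Σ v β • Q β = 0` is mapped by `r ↦ ℓ(P α · r)` to `M v = 0`).
* `eq_zero_of_coincidenceKernel_mulVec_eq_zero` — the COINCIDENCE KERNEL
  `K(α, γ) = 4^{#{i : α i = γ i}}` on `S_m` is nonsingular: `K = Σ_U 3^{|U|} Gram_U`
  (`four_pow_card_agree_eq_sum`) with `Gram_U(α, γ) = [α|_U = γ|_U]` positive semidefinite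
  (`sum_conj_mul_indicator_agree`: `v† Gram_U v = Σ_ρ |fiber sum|²`) and `Gram_univ = 1`, so
  `v† K v = 0` forces `v = 0`.

Used by `Negative/TwoCycleWeight.lean` (realisations of the two-cycle weight `2^{N₂}` on
`S_{2m}` have `dim ≥ m!`, hence `T ∈ VP ⇒ ¬ ClassTransfer`).  No definitions.  References:
flattening / partial-derivative matrices as dimension bounds (Nisan 1991, for noncommutative
branching programs; here for commutative coefficient algebras) and the Gram / Schur-product
positivity argument are folklore. [folklore]
-/

set_option linter.dupNamespace false

noncomputable section

namespace Summit.ValiantsHypothesis.ValiantsHypothesis.Theorems.ClassTransfer.Negative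

open Equiv Finset

/-! ## Flattening: a commutative realisation has dimension at least the rank of any flattening -/

/-- **Flattening bound.** If a linear functional `ℓ` on a commutative algebra `R` realises a
matrix `M` as `M α β = ℓ (P α * Q β)` and `M` has trivial kernel, then `dim R ≥ #ι`: the vectors
`Q β` are linearly independent, since a relation `Σ v β • Q β = 0` is mapped by
`r ↦ ℓ (P α * r)` to `M v = 0`. [folklore] -/
theorem card_le_finrank_of_flattening {R : Type*} [CommRing R] [Algebra ℂ R] [Module.Finite ℂ R]
    {ι : Type*} [Fintype ι] (ℓ : R →ₗ[ℂ] ℂ) (P Q : ι → R) (M : Matrix ι ι ℂ)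
    (hM : ∀ α β, ℓ (P α * Q β) = M α β) (hker : ∀ v : ι → ℂ, M.mulVec v = 0 → v = 0) :
    Fintype.card ι ≤ Module.finrank ℂ R := by
  have hli : LinearIndependent ℂ Q := by
    rw [Fintype.linearIndependent_iff]
    intro v hv β
    have hzero : M.mulVec v = 0 := by
      funext α
      have h1 : ℓ (P α * ∑ b, v b • Q b) = 0 := by rw [hv, mul_zero, map_zero]
      rw [Finset.mul_sum, map_sum] at h1
      simp only [Matrix.mulVec, dotProduct, Pi.zero_apply]
      rw [← h1]
      refine Finset.sum_congr rfl fun b _ => ?_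
      rw [mul_smul_comm, LinearMap.map_smul, hM, smul_eq_mul, mul_comm]
    exact congrFun (hker v hzero) β
  exact hli.fintype_card_le_finrank

/-! ## The coincidence kernel `4^{#{i : α i = γ i}}` on `S_m` is positive definite -/

/-- Two permutations agree on `U` iff their restriction patterns (values on `U`, `none`
elsewhere) coincide. [folklore] -/
theorem restrict_eq_iff {m : ℕ} (U : Finset (Fin m)) (α γ : Perm (Fin m)) :
    ((fun i : Fin m => if i ∈ U then some (α i) else none) =
      fun i : Fin m => if i ∈ U then some (γ i) else none) ↔ ∀ i ∈ U, α i = γ i := by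
  constructor
  · intro h i hi
    have := congrFun h i
    simpa [hi] using this
  · intro h
    funext i
    by_cases hi : i ∈ U
    · simp [hi, h i hi]
    · simp [hi]

/-- **Gram identity** for the indicator kernel "agree on `U`":
`Σ_α Σ_γ conj(w α) [α|_U = γ|_U] w γ = Σ_ρ conj(T ρ) T ρ` with `T ρ` the sum of `w` over the
permutations with restriction pattern `ρ`. [folklore] -/
theorem sum_conj_mul_indicator_agree {m : ℕ} (U : Finset (Fin m)) (w : Perm (Fin m) → ℂ) :
    ∑ α : Perm (Fin m), ∑ γ : Perm (Fin m),
        (starRingEnd ℂ) (w α) * (if (∀ i ∈ U, α i = γ i) then 1 else 0) * w γ =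
      ∑ ρ : Fin m → Option (Fin m),
        (starRingEnd ℂ) (∑ γ ∈ univ.filter
            (fun γ : Perm (Fin m) => (fun i : Fin m => if i ∈ U then some (γ i) else none) = ρ),
              w γ) *
          (∑ γ ∈ univ.filter
            (fun γ : Perm (Fin m) => (fun i : Fin m => if i ∈ U then some (γ i) else none) = ρ),
              w γ) := by
  -- name the pattern map and the fiber sums
  set res : Perm (Fin m) → (Fin m → Option (Fin m)) :=
    fun γ i => if i ∈ U then some (γ i) else none with hres
  set T : (Fin m → Option (Fin m)) → ℂ := fun ρ => ∑ γ ∈ univ.filter (fun γ => res γ = ρ), w γ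
    with hT
  -- inner sum: `Σ_γ conj(w α) [agree] w γ = conj(w α) * T (res α)`
  have hinner : ∀ α : Perm (Fin m),
      ∑ γ : Perm (Fin m), (starRingEnd ℂ) (w α) * (if (∀ i ∈ U, α i = γ i) then 1 else 0) * w γ =
        (starRingEnd ℂ) (w α) * T (res α) := by
    intro α
    simp_rw [mul_assoc]
    rw [← Finset.mul_sum]
    congr 1
    show _ = ∑ γ ∈ univ.filter (fun γ => res γ = res α), w γ
    rw [Finset.sum_filter]
    refine Finset.sum_congr rfl fun γ _ => ?_
    rw [boole_mul]
    refine if_congr ?_ rfl rfl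
    rw [← restrict_eq_iff U α γ]
    exact eq_comm
  rw [Finset.sum_congr rfl fun α _ => hinner α]
  -- regroup by pattern
  rw [← Finset.sum_fiberwise univ res (fun α => (starRingEnd ℂ) (w α) * T (res α))]
  refine Finset.sum_congr rfl fun ρ _ => ?_
  have hfib : ∑ α ∈ univ.filter (fun α => res α = ρ), (starRingEnd ℂ) (w α) * T (res α) =
      ∑ α ∈ univ.filter (fun α => res α = ρ), (starRingEnd ℂ) (w α) * T ρ := by
    refine Finset.sum_congr rfl fun α hα => ?_
    rw [(Finset.mem_filter.1 hα).2]
  rw [hfib, ← Finset.sum_mul, ← map_sum]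

/-- The quadratic form of the indicator kernel "agree on `U`" is a nonnegative real.
[folklore] -/
theorem re_sum_conj_mul_indicator_agree_nonneg {m : ℕ} (U : Finset (Fin m))
    (w : Perm (Fin m) → ℂ) :
    0 ≤ (∑ α : Perm (Fin m), ∑ γ : Perm (Fin m),
        (starRingEnd ℂ) (w α) * (if (∀ i ∈ U, α i = γ i) then 1 else 0) * w γ).re := by
  rw [sum_conj_mul_indicator_agree U w, Complex.re_sum]
  refine Finset.sum_nonneg fun ρ _ => ?_
  rw [← Complex.normSq_eq_conj_mul_self, Complex.ofReal_re]
  exact Complex.normSq_nonneg _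

/-- The coincidence weight expands over subsets:
`4^{#{i : α i = γ i}} = Σ_U 3^{|U|} [α|_U = γ|_U]`. [folklore] -/
theorem four_pow_card_agree_eq_sum {m : ℕ} (α γ : Perm (Fin m)) :
    ((4 : ℂ)) ^ (univ.filter fun i : Fin m => α i = γ i).card =
      ∑ U : Finset (Fin m), (3 : ℂ) ^ U.card * (if (∀ i ∈ U, α i = γ i) then 1 else 0) := by
  set E : Finset (Fin m) := univ.filter fun i : Fin m => α i = γ i with hE
  have hsub : ∀ U : Finset (Fin m), (∀ i ∈ U, α i = γ i) ↔ U ⊆ E := by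
    intro U
    simp only [hE, Finset.subset_iff, Finset.mem_filter, Finset.mem_univ, true_and]
  have hpow : (univ.filter fun U : Finset (Fin m) => U ⊆ E) = E.powerset := by
    ext U
    simp [Finset.mem_powerset]
  calc ((4 : ℂ)) ^ E.card = ((3 : ℂ) + 1) ^ E.card := by norm_num
    _ = ∑ U ∈ E.powerset, (3 : ℂ) ^ U.card * 1 ^ (E.card - U.card) :=
        (Finset.sum_pow_mul_eq_add_pow 3 1 E).symm
    _ = ∑ U ∈ E.powerset, (3 : ℂ) ^ U.card := by simp
    _ = ∑ U : Finset (Fin m), if U ⊆ E then (3 : ℂ) ^ U.card else 0 := by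
        rw [← Finset.sum_filter, hpow]
    _ = ∑ U : Finset (Fin m), (3 : ℂ) ^ U.card * (if (∀ i ∈ U, α i = γ i) then 1 else 0) := by
        refine Finset.sum_congr rfl fun U _ => ?_
        rw [mul_boole]
        exact if_congr (hsub U).symm rfl rfl

/-- **The coincidence kernel `K(α, γ) = 4^{#{i : α i = γ i}}` on `S_m` has trivial kernel**
(it is positive definite: `K = Σ_U 3^{|U|} · Gram_U` with `Gram_univ = 1`). [folklore] -/
theorem eq_zero_of_coincidenceKernel_mulVec_eq_zero {m : ℕ} (v : Perm (Fin m) → ℂ)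
    (hv : ∀ α : Perm (Fin m),
      ∑ γ : Perm (Fin m), ((4 : ℂ)) ^ (univ.filter fun i : Fin m => α i = γ i).card * v γ = 0) :
    v = 0 := by
  -- the quadratic form vanishes
  have hq : ∑ α : Perm (Fin m), (starRingEnd ℂ) (v α) *
      ∑ γ : Perm (Fin m), ((4 : ℂ)) ^ (univ.filter fun i : Fin m => α i = γ i).card * v γ = 0 :=
    Finset.sum_eq_zero fun α _ => by rw [hv α, mul_zero]
  -- expand it over subsets `U`
  have hexp : ∑ α : Perm (Fin m), (starRingEnd ℂ) (v α) *
      ∑ γ : Perm (Fin m), ((4 : ℂ)) ^ (univ.filter fun i : Fin m => α i = γ i).card * v γ =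
      ∑ U : Finset (Fin m), (3 : ℂ) ^ U.card *
        ∑ α : Perm (Fin m), ∑ γ : Perm (Fin m),
          (starRingEnd ℂ) (v α) * (if (∀ i ∈ U, α i = γ i) then 1 else 0) * v γ := by
    symm
    calc ∑ U : Finset (Fin m), (3 : ℂ) ^ U.card *
          ∑ α : Perm (Fin m), ∑ γ : Perm (Fin m),
            (starRingEnd ℂ) (v α) * (if (∀ i ∈ U, α i = γ i) then 1 else 0) * v γ
        = ∑ U : Finset (Fin m), ∑ α : Perm (Fin m), ∑ γ : Perm (Fin m),
            (3 : ℂ) ^ U.card *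
              ((starRingEnd ℂ) (v α) * (if (∀ i ∈ U, α i = γ i) then 1 else 0) * v γ) := by
          simp_rw [Finset.mul_sum]
      _ = ∑ α : Perm (Fin m), ∑ U : Finset (Fin m), ∑ γ : Perm (Fin m),
            (3 : ℂ) ^ U.card *
              ((starRingEnd ℂ) (v α) * (if (∀ i ∈ U, α i = γ i) then 1 else 0) * v γ) :=
          Finset.sum_comm
      _ = ∑ α : Perm (Fin m), (starRingEnd ℂ) (v α) *
            ∑ γ : Perm (Fin m), ((4 : ℂ)) ^ (univ.filter fun i : Fin m => α i = γ i).card * v γ := by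
          refine Finset.sum_congr rfl fun α _ => ?_
          rw [Finset.mul_sum, Finset.sum_comm]
          refine Finset.sum_congr rfl fun γ _ => ?_
          rw [four_pow_card_agree_eq_sum, Finset.sum_mul, Finset.mul_sum]
          refine Finset.sum_congr rfl fun U _ => ?_
          ring
  rw [hexp] at hq
  -- real parts: a sum of nonnegative terms vanishes
  have hre : ∑ U : Finset (Fin m), (3 : ℝ) ^ U.card *
      (∑ α : Perm (Fin m), ∑ γ : Perm (Fin m),
          (starRingEnd ℂ) (v α) * (if (∀ i ∈ U, α i = γ i) then 1 else 0) * v γ).re = 0 := by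
    have := congrArg Complex.re hq
    rw [Complex.re_sum, Complex.zero_re] at this
    rw [← this]
    refine Finset.sum_congr rfl fun U _ => ?_
    rw [show ((3 : ℂ)) ^ U.card = (((3 : ℝ) ^ U.card : ℝ) : ℂ) by push_cast; rfl,
      Complex.re_ofReal_mul]
  have hnonneg : ∀ U ∈ (univ : Finset (Finset (Fin m))), 0 ≤ (3 : ℝ) ^ U.card *
      (∑ α : Perm (Fin m), ∑ γ : Perm (Fin m),
          (starRingEnd ℂ) (v α) * (if (∀ i ∈ U, α i = γ i) then 1 else 0) * v γ).re :=
    fun U _ => mul_nonneg (pow_nonneg (by norm_num) _) (re_sum_conj_mul_indicator_agree_nonneg U v)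
  have huniv := (Finset.sum_eq_zero_iff_of_nonneg hnonneg).1 hre univ (Finset.mem_univ _)
  -- the `U = univ` term is `3^m Σ |v α|²`
  have hdiag : (∑ α : Perm (Fin m), ∑ γ : Perm (Fin m),
      (starRingEnd ℂ) (v α) * (if (∀ i ∈ (univ : Finset (Fin m)), α i = γ i) then 1 else 0) *
        v γ).re = ∑ α : Perm (Fin m), Complex.normSq (v α) := by
    have hterm : ∀ α : Perm (Fin m), ∑ γ : Perm (Fin m),
        (starRingEnd ℂ) (v α) * (if (∀ i ∈ (univ : Finset (Fin m)), α i = γ i) then 1 else 0) *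
          v γ = (Complex.normSq (v α) : ℂ) := by
      intro α
      have hiff : ∀ γ : Perm (Fin m), (∀ i ∈ (univ : Finset (Fin m)), α i = γ i) ↔ α = γ := by
        intro γ
        constructor
        · intro h; exact Equiv.ext fun i => h i (Finset.mem_univ i)
        · rintro rfl i _; rfl
      have hite : ∀ γ : Perm (Fin m),
          (if (∀ i ∈ (univ : Finset (Fin m)), α i = γ i) then (1 : ℂ) else 0) =
            if α = γ then 1 else 0 := fun γ => if_congr (hiff γ) rfl rfl
      simp_rw [hite, mul_assoc, ← Finset.mul_sum, boole_mul]
      rw [Finset.sum_ite_eq, if_pos (Finset.mem_univ α), Complex.normSq_eq_conj_mul_self]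
    rw [Finset.sum_congr rfl fun α _ => hterm α, Complex.re_sum]
    simp
  rw [hdiag] at huniv
  have hsum0 : ∑ α : Perm (Fin m), Complex.normSq (v α) = 0 := by
    have h3 : (0 : ℝ) < (3 : ℝ) ^ (univ : Finset (Fin m)).card := pow_pos (by norm_num) _
    rcases mul_eq_zero.1 huniv with h | h
    · exact absurd h (ne_of_gt h3)
    · exact h
  funext α
  have := (Finset.sum_eq_zero_iff_of_nonneg fun β _ => Complex.normSq_nonneg (v β)).1 hsum0 α
    (Finset.mem_univ α)
  exact Complex.normSq_eq_zero.1 this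

end Summit.ValiantsHypothesis.ValiantsHypothesis.Theorems.ClassTransfer.Negative
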